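import Mathlib
import Summits.NavierStokesRegularity.NavierStokesRegularity.Theorems.FilamentSkeletonRssStadiumRightWingPos
import Summits.NavierStokesRegularity.NavierStokesRegularity.Theorems.FilamentSkeletonRssStadiumCornerConj
import Summits.NavierStokesRegularity.NavierStokesRegularity.Theorems.FilamentSkeletonRssStadiumFrozenPolygon
import Summits.NavierStokesRegularity.NavierStokesRegularity.Theorems.FilamentSkeletonRssStadiumTentFreezeNhds

/-!
# Route `FilamentSkeletonRss` · cruxes `SkeletonJ1L` (stmt-NavierStokesRegularity-23296, registered stub `stub_tangentSkeletonL` ≡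
# `TangentSkeletonNearStraightL`, stmt-23320) · line `child_tangent_analytic_strip_L` (b0b56c52900dd90a), stub `stub_stripPropagation` —
# brick for `rcore`: THE FROZEN RIGHT WING FOR CORNER ANCHORS OF EITHER SIGN OF THE HEIGHT

`Theorems.StadiumRightWingFrozen` treats anchors `0 ≤ Y₀ < hs/4`; `Theorems.StadiumRightWingPosLower` transports the descent certificate to
`−hs/4 < Y₀ ≤ 0`.  Here both are merged: `right_descent_pos_any` (`|Y₀| < hs/4`), and the frozen right wing `P = (z₀, z₀ + hs/5, x₀ + hs/2)` of
EVERY corner-normalised anchor (`|Y₀| < hs/4`, `cc ≤ x₀ < cc + L + hs/4`) is holomorphic and bounded on a ball of targets (`right_wing_frozen_any`,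
via `Theorems.StadiumFrozenPolygon.frozenPolygon_nhds`) with one source-tube radius (`right_wing_tubes_any`, via
`Theorems.StadiumTentFreezeNhds.anchor_tube_polygon`).
HONEST FRAMING: bookkeeping for a HYPOTHETICAL filament skeleton on the NEGATIVE side of a MODEL route; the stub `stub_stripPropagation` is NOT closed
by this file, `TangentSkeletonNearStraightL` / `SkeletonJ1L` stay OPEN; nothing here bears on Navier–Stokes regularity or blow-up.
`--supports stmt-NavierStokesRegularity-23320` (≡ stub `stub_tangentSkeletonL` of 23296).
-/

set_option linter.dupNamespace false

noncomputable section

namespace Summit.NavierStokesRegularity.NavierStokesRegularity.Theorems.StadiumRightWingFrozenAny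

open Set Filter Topology Complex MeasureTheory Metric Finset
open scoped InnerProductSpace Matrix ComplexConjugate
open Summit.NavierStokesRegularity.NavierStokesRegularity.Theorems.StadiumRightWingPos
open Summit.NavierStokesRegularity.NavierStokesRegularity.Theorems.StadiumCornerConj
open Summit.NavierStokesRegularity.NavierStokesRegularity.Theorems.StadiumFrozenPolygon
open Summit.NavierStokesRegularity.NavierStokesRegularity.Theorems.StadiumTentFreezeNhds

/-- (private copy of `Theorems.StadiumRightWingPosLower.right_descent_pos_lower`, olean not yet on the farm at landing time) **Descent positivity for an anchor below the axis.**  `−hs/4 < Y₀ ≤ 0`, `cc ≤ x₀ < cc + L + hs/4`, `F` holomorphic with `‖F′‖ ≤ 2`,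
`Σ F′ᵢ² = 1` and real trace `X`, core continuation with `Re G ≥ g₀ > 0` on the stadium, `κ > 0`: for `t ∈ [0,1]`,
`0 < Re(Σᵢ (Fᵢ z₀ − Fᵢ(p + t(q−p)))² + κ G(p + t(q−p)))` with `p = z₀ + hs/5`, `q = x₀ + hs/2`. [folklore] -/
private theorem right_descent_pos_lower_aux {hs L cc : ℝ} {F : ℂ → (Fin 3 → ℂ)}
    (hF : DifferentiableOn ℂ F {z : ℂ | |z.im| < hs ∧ |z.re - cc| < L + hs})
    (hM : ∀ z ∈ {z : ℂ | |z.im| < hs ∧ |z.re - cc| < L + hs}, ‖deriv F z‖ ≤ 2)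
    (hunit : ∀ w ∈ {z : ℂ | |z.im| < hs ∧ |z.re - cc| < L + hs}, ∑ i, (deriv F w i) ^ 2 = 1)
    {X : ℝ → EuclideanSpace ℝ (Fin 3)} (hX : ContDiff ℝ 1 X) (hXu : ∀ τ, ‖deriv X τ‖ = 1)
    {Rb : ℝ} (hRb0 : 0 ≤ Rb) (hRb : Rb ≤ 1 / 2) (hosc : ∀ τ σ, ‖deriv X τ - deriv X σ‖ ≤ Rb)
    (hFX : ∀ r : ℝ, (r : ℂ) ∈ {z : ℂ | |z.im| < hs ∧ |z.re - cc| < L + hs} →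
      F r = fun i => ((⟪X r, EuclideanSpace.single i (1:ℝ)⟫_ℝ : ℝ) : ℂ))
    (hhs : 0 < hs) {x₀ Y₀ : ℝ} (hY0 : Y₀ ≤ 0) (hY : -(hs / 4) < Y₀) (hx₀ : x₀ < cc + L + hs / 4) (hx₀cc : cc ≤ x₀)
    {G : ℂ → ℂ} {κ g₀ : ℝ} (hκ : 0 < κ) (hg₀ : 0 < g₀)
    (hG : ∀ w ∈ {z : ℂ | |z.im| < hs ∧ |z.re - cc| < L + hs}, g₀ ≤ (G w).re) :
    ∀ t ∈ Icc (0:ℝ) 1,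
      0 < ((∑ i, (F ((x₀ : ℂ) + (Y₀ : ℂ) * Complex.I) i -
          F ((((x₀ + hs / 5 : ℝ) : ℂ) + (Y₀ : ℂ) * Complex.I) + (t : ℂ) *
            (((x₀ + hs / 2 : ℝ) : ℂ) - (((x₀ + hs / 5 : ℝ) : ℂ) + (Y₀ : ℂ) * Complex.I))) i) ^ 2) +
        (κ : ℂ) * G ((((x₀ + hs / 5 : ℝ) : ℂ) + (Y₀ : ℂ) * Complex.I) + (t : ℂ) *
            (((x₀ + hs / 2 : ℝ) : ℂ) - (((x₀ + hs / 5 : ℝ) : ℂ) + (Y₀ : ℂ) * Complex.I)))).re := by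
  intro t ht
  set S : Set ℂ := {z : ℂ | |z.im| < hs ∧ |z.re - cc| < L + hs} with hS
  have hLs : 0 < L + hs := by linarith [hx₀cc, hx₀]
  -- the conjugate anchor is above the axis
  set Y' : ℝ := -Y₀ with hY'
  have hY'0 : 0 ≤ Y' := by rw [hY']; linarith
  have hY'lt : Y' < hs / 4 := by rw [hY']; linarith
  -- the conjugated core continuation keeps the floor
  set G' : ℂ → ℂ := fun w => G (conj w) with hG'
  have hconjS : ∀ w ∈ S, conj w ∈ S := fun w hw => by
    refine ⟨?_, ?_⟩
    · simpa [Complex.conj_im, abs_neg] using hw.1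
    · simpa [Complex.conj_re] using hw.2
  have hG'floor : ∀ w ∈ S, g₀ ≤ (G' w).re := fun w hw => hG _ (hconjS w hw)
  have hup := right_descent_pos hF hM hunit hX hXu hRb0 hRb hosc hFX hhs hY'0 hY'lt hx₀ hx₀cc (G := G') hκ hg₀ hG'floor t ht
  -- the lower points are the conjugates of the upper points
  set z₀ : ℂ := (x₀ : ℂ) + (Y₀ : ℂ) * Complex.I with hz₀
  set ζ : ℂ := (((x₀ + hs / 5 : ℝ) : ℂ) + (Y₀ : ℂ) * Complex.I) + (t : ℂ) *
      (((x₀ + hs / 2 : ℝ) : ℂ) - (((x₀ + hs / 5 : ℝ) : ℂ) + (Y₀ : ℂ) * Complex.I)) with hζ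
  have e : ζ = (((x₀ + (hs / 5 + 3 * hs / 10 * t)) : ℝ) : ℂ) + ((Y₀ * (1 - t) : ℝ) : ℂ) * Complex.I := by
    rw [hζ]; push_cast; ring
  have ez : (x₀ : ℂ) + (Y' : ℂ) * Complex.I = conj z₀ := by
    apply Complex.ext <;> simp [hz₀, hY']
  have eζ : (((x₀ + hs / 5 : ℝ) : ℂ) + (Y' : ℂ) * Complex.I) + (t : ℂ) *
      (((x₀ + hs / 2 : ℝ) : ℂ) - (((x₀ + hs / 5 : ℝ) : ℂ) + (Y' : ℂ) * Complex.I)) = conj ζ := by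
    have e' : (((x₀ + hs / 5 : ℝ) : ℂ) + (Y' : ℂ) * Complex.I) + (t : ℂ) *
        (((x₀ + hs / 2 : ℝ) : ℂ) - (((x₀ + hs / 5 : ℝ) : ℂ) + (Y' : ℂ) * Complex.I)) =
        (((x₀ + (hs / 5 + 3 * hs / 10 * t)) : ℝ) : ℂ) + ((Y' * (1 - t) : ℝ) : ℂ) * Complex.I := by
      push_cast; ring
    rw [e', e]
    set A : ℝ := x₀ + (hs / 5 + 3 * hs / 10 * t) with hA
    set B : ℝ := Y₀ * (1 - t) with hB
    have hB' : Y' * (1 - t) = -B := by rw [hY', hB]; ring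
    rw [hB']
    apply Complex.ext <;> simp
  rw [ez, eζ] at hup
  -- `G' (conj ζ) = G ζ` and the chord square has the same real part at the conjugate pair
  have hG'ζ : G' (conj ζ) = G ζ := by simp [hG']
  rw [hG'ζ] at hup
  have hz₀S : z₀ ∈ S := by
    refine ⟨?_, ?_⟩
    · simp [hz₀]; rw [abs_lt]; constructor <;> linarith
    · simp [hz₀]; rw [abs_lt]; constructor <;> linarith
  have hζS : ζ ∈ S := by
    rw [e]
    refine ⟨?_, ?_⟩
    · simp
      rw [abs_of_nonneg (sub_nonneg.mpr ht.2)]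
      have : |Y₀| < hs / 4 := by rw [abs_lt]; constructor <;> linarith
      nlinarith [abs_nonneg Y₀, ht.1, ht.2]
    · simp; rw [abs_lt]; constructor <;> nlinarith [ht.1, ht.2]
  have hconj := (chord_sq_conj hF hFX hhs hLs hz₀S hζS).2
  -- `Re Σ (F (conj ζ) − F (conj z₀))² = Re Σ (F ζ − F z₀)²`; orientation of the chord is immaterial
  have hsq : ∀ a b : ℂ, (∑ i, (F a i - F b i) ^ 2) = ∑ i, (F b i - F a i) ^ 2 :=
    fun a b => Finset.sum_congr rfl fun i _ => by ring
  rw [Complex.add_re] at hup ⊢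
  rw [hsq (conj z₀) (conj ζ), hconj, ← hsq] at hup
  exact hup


/-- **Descent positivity for every corner anchor, `|Y₀| < hs/4`.** [folklore] -/
theorem right_descent_pos_any {hs L cc : ℝ} {F : ℂ → (Fin 3 → ℂ)}
    (hF : DifferentiableOn ℂ F {z : ℂ | |z.im| < hs ∧ |z.re - cc| < L + hs})
    (hM : ∀ z ∈ {z : ℂ | |z.im| < hs ∧ |z.re - cc| < L + hs}, ‖deriv F z‖ ≤ 2)
    (hunit : ∀ w ∈ {z : ℂ | |z.im| < hs ∧ |z.re - cc| < L + hs}, ∑ i, (deriv F w i) ^ 2 = 1)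
    {X : ℝ → EuclideanSpace ℝ (Fin 3)} (hX : ContDiff ℝ 1 X) (hXu : ∀ τ, ‖deriv X τ‖ = 1)
    {Rb : ℝ} (hRb0 : 0 ≤ Rb) (hRb : Rb ≤ 1 / 2) (hosc : ∀ τ σ, ‖deriv X τ - deriv X σ‖ ≤ Rb)
    (hFX : ∀ r : ℝ, (r : ℂ) ∈ {z : ℂ | |z.im| < hs ∧ |z.re - cc| < L + hs} →
      F r = fun i => ((⟪X r, EuclideanSpace.single i (1:ℝ)⟫_ℝ : ℝ) : ℂ))
    (hhs : 0 < hs) {x₀ Y₀ : ℝ} (hY : |Y₀| < hs / 4) (hx₀ : x₀ < cc + L + hs / 4) (hx₀cc : cc ≤ x₀)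
    {G : ℂ → ℂ} {κ g₀ : ℝ} (hκ : 0 < κ) (hg₀ : 0 < g₀)
    (hG : ∀ w ∈ {z : ℂ | |z.im| < hs ∧ |z.re - cc| < L + hs}, g₀ ≤ (G w).re) :
    ∀ t ∈ Icc (0:ℝ) 1,
      0 < ((∑ i, (F ((x₀ : ℂ) + (Y₀ : ℂ) * Complex.I) i -
          F ((((x₀ + hs / 5 : ℝ) : ℂ) + (Y₀ : ℂ) * Complex.I) + (t : ℂ) *
            (((x₀ + hs / 2 : ℝ) : ℂ) - (((x₀ + hs / 5 : ℝ) : ℂ) + (Y₀ : ℂ) * Complex.I))) i) ^ 2) +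
        (κ : ℂ) * G ((((x₀ + hs / 5 : ℝ) : ℂ) + (Y₀ : ℂ) * Complex.I) + (t : ℂ) *
            (((x₀ + hs / 2 : ℝ) : ℂ) - (((x₀ + hs / 5 : ℝ) : ℂ) + (Y₀ : ℂ) * Complex.I)))).re := by
  have hY' := abs_lt.mp hY
  rcases le_or_gt 0 Y₀ with h | h
  · exact right_descent_pos hF hM hunit hX hXu hRb0 hRb hosc hFX hhs h hY'.2 hx₀ hx₀cc hκ hg₀ hG
  · exact right_descent_pos_lower_aux hF hM hunit hX hXu hRb0 hRb hosc hFX hhs h.le hY'.1 hx₀ hx₀cc hκ hg₀ hG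

/-- **The frozen right wing of a corner anchor of either sign is holomorphic and bounded near the anchor.**  See the module docstring. [folklore] -/
theorem right_wing_frozen_any {hs L cc : ℝ} {F : ℂ → (Fin 3 → ℂ)}
    (hF : DifferentiableOn ℂ F {z : ℂ | |z.im| < hs ∧ |z.re - cc| < L + hs})
    (hM : ∀ z ∈ {z : ℂ | |z.im| < hs ∧ |z.re - cc| < L + hs}, ‖deriv F z‖ ≤ 2)
    (hunit : ∀ w ∈ {z : ℂ | |z.im| < hs ∧ |z.re - cc| < L + hs}, ∑ i, (deriv F w i) ^ 2 = 1)
    {X : ℝ → EuclideanSpace ℝ (Fin 3)} (hX : ContDiff ℝ 1 X) (hXu : ∀ τ, ‖deriv X τ‖ = 1)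
    {Rb : ℝ} (hRb0 : 0 ≤ Rb) (hRb : Rb ≤ 1 / 2) (hosc : ∀ τ σ, ‖deriv X τ - deriv X σ‖ ≤ Rb)
    (hFX : ∀ r : ℝ, (r : ℂ) ∈ {z : ℂ | |z.im| < hs ∧ |z.re - cc| < L + hs} →
      F r = fun i => ((⟪X r, EuclideanSpace.single i (1:ℝ)⟫_ℝ : ℝ) : ℂ))
    {G : ℂ → ℂ} (hG : ContinuousOn G {z : ℂ | |z.im| < hs ∧ |z.re - cc| < L + hs})
    {κ g₀ : ℝ} (hκ : 0 < κ) (hg₀ : 0 < g₀) (hGre : ∀ w ∈ {z : ℂ | |z.im| < hs ∧ |z.re - cc| < L + hs}, g₀ ≤ (G w).re)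
    (hhs : 0 < hs) {x₀ Y₀ : ℝ} (hYabs : |Y₀| < hs / 4) (hx₀ : x₀ < cc + L + hs / 4) (hx₀cc : cc ≤ x₀) :
    let P : ℕ → ℂ := fun k => if k = 0 then (x₀ : ℂ) + (Y₀ : ℂ) * Complex.I
      else if k = 1 then ((x₀ : ℂ) + (Y₀ : ℂ) * Complex.I) + ((hs / 5 : ℝ) : ℂ) else ((x₀ + hs / 2 : ℝ) : ℂ)
    ∃ δ C : ℝ, 0 < δ ∧ ball ((x₀ : ℂ) + (Y₀ : ℂ) * Complex.I) δ ⊆ {z : ℂ | |z.im| < hs ∧ |z.re - cc| < L + hs} ∧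
      DifferentiableOn ℂ (fun z => ∑ k ∈ range 2, ∫ t in (0:ℝ)..1, (P (k+1) - P k) •
        ((((∑ i, (F z i - F (P k + (t : ℂ) * (P (k+1) - P k)) i) ^ 2) +
            (κ : ℂ) * G (P k + (t : ℂ) * (P (k+1) - P k))) ^ ((3:ℂ) / 2))⁻¹ •
          (deriv F (P k + (t : ℂ) * (P (k+1) - P k)) ⨯₃
            (fun i => F z i - F (P k + (t : ℂ) * (P (k+1) - P k)) i))))
        (ball ((x₀ : ℂ) + (Y₀ : ℂ) * Complex.I) δ) ∧
      ∀ z ∈ ball ((x₀ : ℂ) + (Y₀ : ℂ) * Complex.I) δ, ‖∑ k ∈ range 2, ∫ t in (0:ℝ)..1, (P (k+1) - P k) •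
        ((((∑ i, (F z i - F (P k + (t : ℂ) * (P (k+1) - P k)) i) ^ 2) +
            (κ : ℂ) * G (P k + (t : ℂ) * (P (k+1) - P k))) ^ ((3:ℂ) / 2))⁻¹ •
          (deriv F (P k + (t : ℂ) * (P (k+1) - P k)) ⨯₃
            (fun i => F z i - F (P k + (t : ℂ) * (P (k+1) - P k)) i)))‖ ≤ C := by
  intro P
  have hP0 : P 0 = (x₀ : ℂ) + (Y₀ : ℂ) * Complex.I := by simp [P]
  have hP1 : P 1 = ((x₀ : ℂ) + (Y₀ : ℂ) * Complex.I) + ((hs / 5 : ℝ) : ℂ) := by simp [P]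
  have hP2 : P 2 = ((x₀ + hs / 2 : ℝ) : ℂ) := by simp [P]
  have hP1' : P 1 = (((x₀ + hs / 5 : ℝ) : ℂ) + (Y₀ : ℂ) * Complex.I) := by rw [hP1]; push_cast; ring
  have hz₀S : (x₀ : ℂ) + (Y₀ : ℂ) * Complex.I ∈ {z : ℂ | |z.im| < hs ∧ |z.re - cc| < L + hs} := by
    constructor
    · simp; linarith [abs_lt.mp hYabs]
    · simp; rw [abs_lt]; constructor <;> linarith
  obtain ⟨hsegA, hsegB⟩ := right_wing_in_stadium (L := L) (cc := cc) hhs hYabs hx₀ hx₀cc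
  have hposA := right_plateau_pos hF hM hunit hhs hYabs hx₀ hx₀cc hκ hg₀ hGre
  have hposB := right_descent_pos_any hF hM hunit hX hXu hRb0 hRb hosc hFX hhs hYabs hx₀ hx₀cc hκ hg₀ hGre
  have hseg : ∀ k < 2, ∀ t ∈ Icc (0:ℝ) 1, P k + (t : ℂ) * (P (k+1) - P k) ∈ {z : ℂ | |z.im| < hs ∧ |z.re - cc| < L + hs} := by
    intro k hk t ht
    interval_cases k
    · rw [show (0:ℕ) + 1 = 1 from rfl, hP0, hP1]; exact hsegA t ht
    · rw [show (1:ℕ) + 1 = 2 from rfl, hP1', hP2]; exact hsegB t ht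
  have hpos : ∀ k < 2, ∀ t ∈ Icc (0:ℝ) 1,
      0 < ((∑ i, (F ((x₀ : ℂ) + (Y₀ : ℂ) * Complex.I) i - F (P k + (t : ℂ) * (P (k+1) - P k)) i) ^ 2) +
        (κ : ℂ) * G (P k + (t : ℂ) * (P (k+1) - P k))).re := by
    intro k hk t ht
    interval_cases k
    · rw [show (0:ℕ) + 1 = 1 from rfl, hP0, hP1]; exact hposA t ht
    · rw [show (1:ℕ) + 1 = 2 from rfl, hP1', hP2]; exact hposB t ht
  exact frozenPolygon_nhds hF hM zero_le_two hG hz₀S (κ := κ) P 2 hseg hpos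

/-- **One source-tube radius for the right wing (either sign)**, for all targets of a ball around the corner anchor (`G` holomorphic). [folklore] -/
theorem right_wing_tubes_any {hs L cc : ℝ} {F : ℂ → (Fin 3 → ℂ)}
    (hF : DifferentiableOn ℂ F {z : ℂ | |z.im| < hs ∧ |z.re - cc| < L + hs})
    (hM : ∀ z ∈ {z : ℂ | |z.im| < hs ∧ |z.re - cc| < L + hs}, ‖deriv F z‖ ≤ 2)
    (hunit : ∀ w ∈ {z : ℂ | |z.im| < hs ∧ |z.re - cc| < L + hs}, ∑ i, (deriv F w i) ^ 2 = 1)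
    {X : ℝ → EuclideanSpace ℝ (Fin 3)} (hX : ContDiff ℝ 1 X) (hXu : ∀ τ, ‖deriv X τ‖ = 1)
    {Rb : ℝ} (hRb0 : 0 ≤ Rb) (hRb : Rb ≤ 1 / 2) (hosc : ∀ τ σ, ‖deriv X τ - deriv X σ‖ ≤ Rb)
    (hFX : ∀ r : ℝ, (r : ℂ) ∈ {z : ℂ | |z.im| < hs ∧ |z.re - cc| < L + hs} →
      F r = fun i => ((⟪X r, EuclideanSpace.single i (1:ℝ)⟫_ℝ : ℝ) : ℂ))
    {G : ℂ → ℂ} (hG : DifferentiableOn ℂ G {z : ℂ | |z.im| < hs ∧ |z.re - cc| < L + hs})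
    {κ g₀ : ℝ} (hκ : 0 < κ) (hg₀ : 0 < g₀) (hGre : ∀ w ∈ {z : ℂ | |z.im| < hs ∧ |z.re - cc| < L + hs}, g₀ ≤ (G w).re)
    (hhs : 0 < hs) {x₀ Y₀ : ℝ} (hYabs : |Y₀| < hs / 4) (hx₀ : x₀ < cc + L + hs / 4) (hx₀cc : cc ≤ x₀) :
    let P : ℕ → ℂ := fun k => if k = 0 then (x₀ : ℂ) + (Y₀ : ℂ) * Complex.I
      else if k = 1 then ((x₀ : ℂ) + (Y₀ : ℂ) * Complex.I) + ((hs / 5 : ℝ) : ℂ) else ((x₀ + hs / 2 : ℝ) : ℂ)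
    ∃ δ : ℝ, 0 < δ ∧ ball ((x₀ : ℂ) + (Y₀ : ℂ) * Complex.I) δ ⊆ {z : ℂ | |z.im| < hs ∧ |z.re - cc| < L + hs} ∧
      ∀ z ∈ ball ((x₀ : ℂ) + (Y₀ : ℂ) * Complex.I) δ, ∀ k < 2, ∀ t ∈ Icc (0:ℝ) 1,
        ball (P k + (t : ℂ) * (P (k+1) - P k)) δ ⊆
          {ζ : ℂ | ζ ∈ {z : ℂ | |z.im| < hs ∧ |z.re - cc| < L + hs} ∧
            0 < ((∑ i, (F z i - F ζ i) ^ 2) + (κ : ℂ) * G ζ).re} := by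
  intro P
  have hP0 : P 0 = (x₀ : ℂ) + (Y₀ : ℂ) * Complex.I := by simp [P]
  have hP1 : P 1 = ((x₀ : ℂ) + (Y₀ : ℂ) * Complex.I) + ((hs / 5 : ℝ) : ℂ) := by simp [P]
  have hP2 : P 2 = ((x₀ + hs / 2 : ℝ) : ℂ) := by simp [P]
  have hP1' : P 1 = (((x₀ + hs / 5 : ℝ) : ℂ) + (Y₀ : ℂ) * Complex.I) := by rw [hP1]; push_cast; ring
  have hz₀S : (x₀ : ℂ) + (Y₀ : ℂ) * Complex.I ∈ {z : ℂ | |z.im| < hs ∧ |z.re - cc| < L + hs} := by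
    constructor
    · simp; linarith [abs_lt.mp hYabs]
    · simp; rw [abs_lt]; constructor <;> linarith
  obtain ⟨hsegA, hsegB⟩ := right_wing_in_stadium (L := L) (cc := cc) hhs hYabs hx₀ hx₀cc
  have hposA := right_plateau_pos hF hM hunit hhs hYabs hx₀ hx₀cc hκ hg₀ hGre
  have hposB := right_descent_pos_any hF hM hunit hX hXu hRb0 hRb hosc hFX hhs hYabs hx₀ hx₀cc hκ hg₀ hGre
  have hseg : ∀ k < 2, ∀ t ∈ Icc (0:ℝ) 1, P k + (t : ℂ) * (P (k+1) - P k) ∈ {z : ℂ | |z.im| < hs ∧ |z.re - cc| < L + hs} := by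
    intro k hk t ht
    interval_cases k
    · rw [show (0:ℕ) + 1 = 1 from rfl, hP0, hP1]; exact hsegA t ht
    · rw [show (1:ℕ) + 1 = 2 from rfl, hP1', hP2]; exact hsegB t ht
  have hpos : ∀ k < 2, ∀ t ∈ Icc (0:ℝ) 1,
      0 < ((∑ i, (F ((x₀ : ℂ) + (Y₀ : ℂ) * Complex.I) i - F (P k + (t : ℂ) * (P (k+1) - P k)) i) ^ 2) +
        (κ : ℂ) * G (P k + (t : ℂ) * (P (k+1) - P k))).re := by
    intro k hk t ht
    interval_cases k
    · rw [show (0:ℕ) + 1 = 1 from rfl, hP0, hP1]; exact hposA t ht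
    · rw [show (1:ℕ) + 1 = 2 from rfl, hP1', hP2]; exact hposB t ht
  exact anchor_tube_polygon hF hG hz₀S (κ := κ) P 2 hseg hpos

end Summit.NavierStokesRegularity.NavierStokesRegularity.Theorems.StadiumRightWingFrozenAny

end
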